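import Summits.KontsevichZagierPeriods.KontsevichZagierPeriods.Theorems.LinRedNormalFormArrangementNormalFormStubUnletterNecessity

/-!
# `ArrangementNormalForm` (stmt-KontsevichZagierPeriods-3915), line `janus-bands`, stub `stub_unletter` — (3/5) eliminating a letter-free coordinate

Support file for `stub_unletter` (Janus band representations of base dimension `0` are congruent,
modulo `KZ.relations`, to `ℤ`-combinations of LETTERED ORDER CELLS).  The normal form of the whole
argument is a representation on the open ordered simplex
`Δ_w = KZ.openOrderedSimplex w = {1 > t₀ > ⋯ > t_{w-1} > 0}` with integrand
`cint G a t = G(t) · ∏ᵢ lett (a i) (tᵢ)` (`G` a polynomial over `ℚ`, `a i : Option ℚ` an optional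
simple constant letter, `lett (some c) x = 1/(x - c)`, `lett none x = 1`); the letters are ADMISSIBLE
(`Adm`) when none lies in `(0, 1)`, the top coordinate `t₀` is not lettered `1` and the bottom
coordinate `t_{w-1}` is not lettered `0`.  All helper declarations live in the sub-namespace
`…JanusBands.Unletter`.

This file: the relabelling `moveLast`, closing an open band and descending by ONE Newton–Leibniz move
(`closeBand`), and STEP (E) (`stepE`): an admissible representation of dimension `n + 1` with a
letter-free coordinate is congruent to an admissible representation of dimension `n` (rule 2:
coordinate permutation; rule 3 with the polynomial primitive `antider`; an inadmissible letter `0`/`1`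
created at the new bottom/top coordinate is cancelled by the exact division of the new weight by
`up − lo`).

References: M. Kontsevich, D. Zagier, *Periods* (2001), §1.2; D. Zagier, *Values of zeta functions
and their applications* (1994), §9 (convergence of iterated integrals).
-/

noncomputable section

open Set MeasureTheory MvPolynomial
open Literature.NumberTheory.Transcendental
open Literature.ModelTheory.ExponentialFields (IsSemialgebraic)

namespace Summit.KontsevichZagierPeriods.ArrangementNormalForm.JanusBands

/-- Registered support goal of this file: evaluating the substitution `Fin.snoc X P` at a point. -/
theorem unletter_aeval_comp_snoc (n : ℕ) (x : Fin n → ℝ) (P : MvPolynomial (Fin n) ℚ) : (fun i => (MvPolynomial.aeval x ((Fin.snoc (fun i => MvPolynomial.X i) P : Fin (n + 1) → MvPolynomial (Fin n) ℚ) i) : ℝ)) = Fin.snoc x (MvPolynomial.aeval x P) := by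
  ext i
  induction i using Fin.lastCases with
  | last => simp
  | cast j => simp

namespace Unletter

/-- `moveLast u` sends `u` to the last place. -/
@[simp] theorem moveLast_apply_self {n : ℕ} (u : Fin (n + 1)) : moveLast u u = Fin.last n := by
  simp [moveLast]

/-- `moveLast u` sends `u.succAbove j` to `castSucc j`. -/
@[simp] theorem moveLast_apply_succAbove {n : ℕ} (u : Fin (n + 1)) (j : Fin n) :
    moveLast u (u.succAbove j) = Fin.castSucc j := by
  simp [moveLast]

/-- The inverse relabelling on the last place. -/
@[simp] theorem moveLast_symm_last {n : ℕ} (u : Fin (n + 1)) : (moveLast u).symm (Fin.last n) = u :=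
  (Equiv.symm_apply_eq _).2 (moveLast_apply_self u).symm

/-- The inverse relabelling on the other places. -/
@[simp] theorem moveLast_symm_castSucc {n : ℕ} (u : Fin (n + 1)) (j : Fin n) :
    (moveLast u).symm (Fin.castSucc j) = u.succAbove j :=
  (Equiv.symm_apply_eq _).2 (moveLast_apply_succAbove u j).symm

/-- Pulling back along `moveLast u` inserts the last coordinate at position `u`. -/
theorem comp_moveLast {n : ℕ} (u : Fin (n + 1)) (z : Fin (n + 1) → ℝ) :
    (fun i => z (moveLast u i)) = u.insertNth (z (Fin.last n)) (Fin.init z) := by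
  ext i
  rcases Fin.eq_self_or_eq_succAbove u i with rfl | ⟨j, rfl⟩
  · simp
  · simp [Fin.init]

/-- Relabelling a class integrand. -/
theorem cint_comp_equiv {w : ℕ} (G : MvPolynomial (Fin w) ℚ) (a : Fin w → Option ℚ)
    (e : Fin w ≃ Fin w) (z : Fin w → ℝ) :
    cint G a (fun i => z (e i)) = cint (rename e G) (fun i => a (e.symm i)) z := by
  rw [cint, cint, aeval_rename]
  congr 1
  exact (Equiv.prod_comp e (fun i => lett (a (e.symm i)) (z i))).symm.trans (by simp) |>.symm

/-- **Closing an open band and descending by Newton–Leibniz** (bookkeeping adapted from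
`FurushoPentagon.HoffmanRelationInKZ.descents_closeBand`): an open sub-band `R` of the closed band
over `rb` with null complement, kernel `W` and fibrewise primitive `F`, descends onto `rb` by one
domain-additivity move, one null representation and ONE `KZ.newtonLeibnizRel` move
(Kontsevich–Zagier 2001, §1.2 rule (3)); stated directly as membership in `RS`. -/
theorem closeBand {m : ℕ} (R : KZ.IntegralRep (m + 1)) (rb : KZ.IntegralRep m)
    (a b : (Fin m → ℝ) → ℝ) (W F : (Fin (m + 1) → ℝ) → ℝ)
    (ha : IsSemialgebraicFunOn ℚ rb.domain a) (hb : IsSemialgebraicFunOn ℚ rb.domain b)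
    (hab : ∀ x ∈ rb.domain, a x ≤ b x)
    (hW : IsSemialgebraicFunOn ℚ (KZlog.band rb.domain a b) W)
    (hF : IsSemialgebraicFunOn ℚ (KZlog.band rb.domain a b) F)
    (hcont : ∀ x ∈ rb.domain, ContinuousOn (fun t : ℝ => F (Fin.snoc x t)) (Icc (a x) (b x)))
    (hder : ∀ x ∈ rb.domain, ∀ t ∈ Ioo (a x) (b x),
      HasDerivAt (fun s : ℝ => F (Fin.snoc x s)) (W (Fin.snoc x t)) t)
    (hbase : ∀ x ∈ rb.domain, rb.integrand x = F (Fin.snoc x (b x)) - F (Fin.snoc x (a x)))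
    (hRsub : R.domain ⊆ KZlog.band rb.domain a b) (hRW : EqOn R.integrand W R.domain)
    (hnull : volume (KZlog.band rb.domain a b \ R.domain) = 0) (hrb : KZ.of rb ∈ RS) :
    KZ.of R ∈ RS := by
  have hband : IsSemialgebraic ℚ (KZlog.band rb.domain a b) := KZlog.isSemialgebraic_band ha hb
  have hRm : MeasurableSet R.domain := KZ.IntegralRep.measurableSet_domain_holds R
  have hWR : IntegrableOn W R.domain := R.integrableOn.congr_fun hRW hRm
  have hWband : IntegrableOn W (KZlog.band rb.domain a b) :=
    hWR.mono_set_ae (ae_le_set.mpr hnull)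
  set Rc : KZ.IntegralRep (m + 1) := ⟨KZlog.band rb.domain a b, W, hband, hW, hWband⟩ with hRc
  set Rf : KZ.IntegralRep (m + 1) := Rc.restrict (KZlog.band rb.domain a b \ R.domain)
    (hband.diff R.isSemialgebraic_domain) Set.sdiff_subset with hRf
  have h1 : KZ.of Rc - KZ.of R - KZ.of Rf ∈ KZ.relations := by
    refine KZ.domainAddRel_subset_relations ⟨m + 1, Rc, R, Rf, ?_, ?_,
      fun z hz => (hRW hz).symm, fun _ _ => rfl, rfl⟩
    · change KZlog.band rb.domain a b = R.domain ∪ (KZlog.band rb.domain a b \ R.domain)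
      rw [Set.union_sdiff_cancel hRsub]
    · change volume (R.domain ∩ (KZlog.band rb.domain a b \ R.domain)) = 0
      rw [Set.inter_sdiff_self, measure_empty]
  have h2 : KZ.of Rf ∈ KZ.relations := KZ.of_mem_relations_of_volume_eq_zero Rf hnull
  have h3 : KZ.of Rc - KZ.of rb ∈ KZ.relations :=
    KZ.newtonLeibnizRel_subset_relations
      ⟨m, Rc, rb, a, b, F, hF, ha, hb, hab, rfl, hcont, hder, hbase, rfl⟩
  have : KZ.of R - KZ.of rb =
      (KZ.of Rc - KZ.of rb) - (KZ.of Rc - KZ.of R - KZ.of Rf) - KZ.of Rf := by abel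
  refine mem_RS_of_sub_mem ?_ hrb
  rw [this]
  exact KZ.relations.sub_mem (KZ.relations.sub_mem h3 h1) h2

/-- **Step (E): eliminating one letter-free coordinate.** If every admissible representation of
dimension `n` lies in `RS`, so does every admissible representation of dimension `n + 1` with a
letter-free coordinate `u`: move `u` to the last place (a coordinate permutation), close the band
`loP u ≤ t ≤ upP u` over `Δ_n` and integrate `t` out by ONE Newton–Leibniz move with the polynomial
primitive `antider`; the new polynomial weight `Pr(up) − Pr(lo)` is divisible by `up − lo`, which
cancels an inadmissible letter `0` (resp. `1`) appearing at the new bottom (resp. top) coordinate. -/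
theorem stepE {n : ℕ} (IH : OC n ⊆ (RS : Set KZ.FormalRep)) (s : KZ.IntegralRep (n + 1))
    (G : MvPolynomial (Fin (n + 1)) ℚ) (a : Fin (n + 1) → Option ℚ) (ha : a ∈ Adm (n + 1))
    (hdom : s.domain = KZ.openOrderedSimplex (n + 1))
    (hint : EqOn s.integrand (cint G a) (KZ.openOrderedSimplex (n + 1)))
    (u : Fin (n + 1)) (hu : a u = none) : KZ.of s ∈ RS := by
  classical
  -- the new letters and the transported polynomial data
  obtain ⟨a', ha'⟩ : ∃ a' : Fin n → Option ℚ, a' = fun j => a (u.succAbove j) := ⟨_, rfl⟩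
  have ha'j : ∀ j, a' j = a (u.succAbove j) := fun j => by rw [ha']
  obtain ⟨ah, hah⟩ : ∃ ah : Fin (n + 1) → Option ℚ, ah = fun i => a ((moveLast u).symm i) :=
    ⟨_, rfl⟩
  have hah_last : ah (Fin.last n) = none := by rw [hah]; simp [hu]
  have hah_cs : ∀ j, ah (Fin.castSucc j) = a' j := fun j => by rw [hah, ha']; simp
  obtain ⟨H, hH⟩ : ∃ H : MvPolynomial (Fin (n + 1)) ℚ, H = rename (moveLast u) G := ⟨_, rfl⟩
  obtain ⟨Pr, hPr⟩ : ∃ Pr : MvPolynomial (Fin (n + 1)) ℚ, Pr = antider H := ⟨_, rfl⟩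
  obtain ⟨G', hG'⟩ : ∃ G' : MvPolynomial (Fin n) ℚ, G' =
      bind₁ (Fin.snoc (fun i => X i) (upP u) : Fin (n + 1) → MvPolynomial (Fin n) ℚ) Pr -
      bind₁ (Fin.snoc (fun i => X i) (loP u) : Fin (n + 1) → MvPolynomial (Fin n) ℚ) Pr := ⟨_, rfl⟩
  obtain ⟨G'', hG''⟩ := sub_dvd_bindSnoc_sub Pr (upP u) (loP u)
  rw [← hG'] at hG''
  have ha'sub : ∀ j c, a' j = some c → c ≤ 0 ∨ 1 ≤ c := fun j c h =>
    (ha _ c (by rw [ha'] at h; exact h)).1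
  have hden' : ∀ x ∈ KZ.openOrderedSimplex n, ∀ j, den (a' j) (x j) ≠ 0 := fun x hx j =>
    den_ne_zero_of ⟨hx.1 j, hx.2.1 j⟩ (ha'sub j)
  -- the class integrands on fibres
  have hcsnoc : ∀ (P : MvPolynomial (Fin (n + 1)) ℚ) (x : Fin n → ℝ) (t : ℝ),
      cint P ah (Fin.snoc x t) = aeval (Fin.snoc x t : Fin (n + 1) → ℝ) P *
        ∏ j, lett (a' j) (x j) := fun P x t => by
    rw [cint, Fin.prod_univ_castSucc]
    simp [hah_last, hah_cs]
  have hWins : ∀ (x : Fin n → ℝ) (t : ℝ), cint G a (u.insertNth t x) = cint H ah (Fin.snoc x t) :=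
    fun x t => by
    have h := comp_moveLast u (Fin.snoc x t : Fin (n + 1) → ℝ)
    simp only [Fin.snoc_last, Fin.init_snoc] at h
    rw [← h, cint_comp_equiv, hH, hah]
  -- the common tail of the argument
  have finish : ∀ (Gn : MvPolynomial (Fin n) ℚ) (an : Fin n → Option ℚ), an ∈ Adm n →
      (∀ x ∈ KZ.openOrderedSimplex n, cint Gn an x = aeval x G' * ∏ j, lett (a' j) (x j)) →
      KZ.of s ∈ RS := by
    intro Gn an han heq
    let rb : KZ.IntegralRep n := ⟨KZ.openOrderedSimplex n, cint Gn an,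
      KZ.isSemialgebraic_openOrderedSimplex n,
      isSemialgebraicFunOn_cint Gn an (KZ.isSemialgebraic_openOrderedSimplex n)
        (fun x hx j => den_ne_zero_of_adm han hx j), integrableOn_cint Gn han⟩
    have hrb : KZ.of rb ∈ RS := IH ⟨rb, Gn, an, han, rfl, fun x _ => rfl, rfl⟩
    have h1 : KZ.of s - KZ.of (s.reindex (moveLast u)) ∈ KZ.relations :=
      KZ.of_sub_of_reindex_mem_relations s (moveLast u)
    -- the band data
    have hlo : IsSemialgebraicFunOn ℚ (KZ.openOrderedSimplex n) fun x => (aeval x (loP u) : ℝ) :=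
      isSemialgebraicFunOn_aeval (KZ.isSemialgebraic_openOrderedSimplex n) _
    have hup : IsSemialgebraicFunOn ℚ (KZ.openOrderedSimplex n) fun x => (aeval x (upP u) : ℝ) :=
      isSemialgebraicFunOn_aeval (KZ.isSemialgebraic_openOrderedSimplex n) _
    have hab : ∀ x ∈ KZ.openOrderedSimplex n, (aeval x (loP u) : ℝ) ≤ aeval x (upP u) := by
      intro x hx
      rw [aeval_loP, aeval_upP]
      split_ifs with h1 h2 h2
      · exact (hx.2.1 _).le
      · exact hx.2.2.antitone (by rw [Fin.le_def]; simp only; omega)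
      · exact zero_le_one
      · exact (hx.1 _).le
    have hbandpt : ∀ z ∈ KZlog.band (KZ.openOrderedSimplex n) (fun x => (aeval x (loP u) : ℝ))
        (fun x => (aeval x (upP u) : ℝ)), ∀ i, den (ah i) (z i) ≠ 0 := by
      intro z hz i
      induction i using Fin.lastCases with
      | last => rw [hah_last]; simp
      | cast j => rw [hah_cs]; exact hden' _ hz.1 j
    have hband : IsSemialgebraic ℚ (KZlog.band (KZ.openOrderedSimplex n)
        (fun x => (aeval x (loP u) : ℝ)) (fun x => (aeval x (upP u) : ℝ))) :=
      KZlog.isSemialgebraic_band hlo hup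
    have h2 : KZ.of (s.reindex (moveLast u)) ∈ RS := by
      refine closeBand (s.reindex (moveLast u)) rb _ _ (cint H ah) (cint Pr ah) hlo hup hab
        (isSemialgebraicFunOn_cint H ah hband hbandpt) (isSemialgebraicFunOn_cint Pr ah hband hbandpt)
        (fun x _ => ?_) (fun x _ t _ => ?_) (fun x hx => ?_) (fun z hz => ?_) (fun z hz => ?_) ?_ hrb
      · -- continuity of the primitive on the closed fibre
        have : (fun t : ℝ => cint Pr ah (Fin.snoc x t)) = fun t =>
            aeval (Fin.snoc x t : Fin (n + 1) → ℝ) Pr * ∏ j, lett (a' j) (x j) := funext (hcsnoc Pr x)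
        rw [this, hPr]
        exact ((continuous_iff_continuousAt.2 fun t =>
          (hasDerivAt_aeval_antider H x t).continuousAt).mul continuous_const).continuousOn
      · -- derivative
        have : (fun t : ℝ => cint Pr ah (Fin.snoc x t)) = fun t =>
            aeval (Fin.snoc x t : Fin (n + 1) → ℝ) Pr * ∏ j, lett (a' j) (x j) := funext (hcsnoc Pr x)
        rw [this, hcsnoc, hPr]
        exact (hasDerivAt_aeval_antider H x t).mul_const _
      · -- the base integrand
        change cint Gn an x = _
        rw [heq x hx, hcsnoc, hcsnoc, ← sub_mul, hG', map_sub, aeval_bind₁, aeval_bind₁,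
          unletter_aeval_comp_snoc, unletter_aeval_comp_snoc]
      · -- the open band lies in the closed band
        change (fun i => z (moveLast u i)) ∈ s.domain at hz
        rw [hdom, comp_moveLast, insertNth_mem_simplex_iff] at hz
        exact ⟨hz.1, hz.2.1.le, hz.2.2.le⟩
      · -- the integrand of the reindexed representation
        change (fun i => z (moveLast u i)) ∈ s.domain at hz
        change s.integrand (fun i => z (moveLast u i)) = _
        rw [hdom] at hz
        rw [hint hz, ← Fin.snoc_init_self z, ← hWins, ← comp_moveLast, Fin.snoc_init_self]
      · -- the two faces are null
        refine measure_mono_null (fun z hz => ?_)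
          (measure_union_null (KZ.volume_graph_eq_zero hlo) (KZ.volume_graph_eq_zero hup))
        have hz2 : ¬ ((fun i => z (moveLast u i)) ∈ s.domain) := hz.2
        rw [hdom, comp_moveLast, insertNth_mem_simplex_iff] at hz2
        obtain ⟨hz1, hlo', hup'⟩ := hz.1
        by_cases h : z (Fin.last n) = aeval (Fin.init z) (loP u)
        · exact Or.inl ⟨hz1, h⟩
        · refine Or.inr ⟨hz1, ?_⟩
          by_contra h'
          exact hz2 ⟨hz1, lt_of_le_of_ne hlo' (Ne.symm h), lt_of_le_of_ne hup' h'⟩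
    exact mem_RS_of_sub_mem h1 h2
  -- the product of the old letters, split at a position
  have hsplit : ∀ (x : Fin n → ℝ) (j₀ : Fin n) (b : Fin n → Option ℚ),
      ∏ j, lett (b j) (x j) = lett (b j₀) (x j₀) * ∏ j ∈ Finset.univ.erase j₀, lett (b j) (x j) :=
    fun x j₀ b => (Finset.mul_prod_erase _ _ (Finset.mem_univ j₀)).symm
  have hupd : ∀ (x : Fin n → ℝ) (j₀ : Fin n),
      ∏ j ∈ Finset.univ.erase j₀, lett (Function.update a' j₀ none j) (x j) =
        ∏ j ∈ Finset.univ.erase j₀, lett (a' j) (x j) := fun x j₀ =>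
    Finset.prod_congr rfl fun j hj => by rw [Function.update_of_ne (Finset.ne_of_mem_erase hj)]
  -- which letter must be cancelled
  by_cases hA : u = Fin.last n ∧ ∃ j : Fin n, (j : ℕ) + 1 = n ∧ a' j = some 0
  · obtain ⟨hul, j₀, hj₀, hj₀'⟩ := hA
    have hn : (u : ℕ) = n := by rw [hul]; rfl
    refine finish G'' (Function.update a' j₀ none) (fun j c hjc => ?_) (fun x hx => ?_)
    · have hj : j ≠ j₀ := by rintro rfl; simp at hjc
      rw [Function.update_of_ne hj] at hjc
      refine ⟨ha'sub j c hjc, fun hj0 => ?_, fun hjn => absurd (Fin.ext (by omega)) hj⟩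
      have : a (Fin.castSucc j) = some c := by
        rw [ha', hul] at hjc; simpa using hjc
      exact (ha _ c this).2.1 (by simpa using hj0)
    · have hx0 : x j₀ ≠ 0 := (hx.1 j₀).ne'
      have hup' : (aeval x (upP u) : ℝ) = x j₀ := by
        rw [aeval_upP, dif_neg (by omega)]; congr 1; ext; simp only; omega
      have hlo' : (aeval x (loP u) : ℝ) = 0 := by rw [aeval_loP, dif_neg (by omega)]
      rw [hG'', map_mul, map_sub, hup', hlo', cint, hsplit x j₀, hsplit x j₀, hupd,
        Function.update_self, hj₀', lett_none, lett_some]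
      simp only [Rat.cast_zero, sub_zero, one_mul]
      field_simp
  by_cases hB : (u : ℕ) = 0 ∧ ∃ j : Fin n, (j : ℕ) = 0 ∧ a' j = some 1
  · obtain ⟨hu0, j₀, hj₀, hj₀'⟩ := hB
    refine finish (-G'') (Function.update a' j₀ none) (fun j c hjc => ?_) (fun x hx => ?_)
    · have hj : j ≠ j₀ := by rintro rfl; simp at hjc
      rw [Function.update_of_ne hj] at hjc
      refine ⟨ha'sub j c hjc, fun hj0 => absurd (Fin.ext (by omega)) hj, fun hjn => ?_⟩
      have : a (Fin.succ j) = some c := by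
        rw [ha'j] at hjc
        rwa [Fin.succAbove_of_le_castSucc u j (by rw [Fin.le_def]; simp only [Fin.val_castSucc]; omega)]
          at hjc
      exact (ha _ c this).2.2 (by simp only [Fin.val_succ]; omega)
    · have hx1 : x j₀ - 1 ≠ 0 := sub_ne_zero.2 (hx.2.1 j₀).ne
      have hup' : (aeval x (upP u) : ℝ) = 1 := by rw [aeval_upP, dif_pos hu0]
      have hlo' : (aeval x (loP u) : ℝ) = x j₀ := by
        rw [aeval_loP, dif_pos (by omega)]; congr 1; ext; simp only; omega
      rw [hG'', map_mul, map_sub, hup', hlo', cint, map_neg, hsplit x j₀, hsplit x j₀, hupd,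
        Function.update_self, hj₀', lett_none, lett_some]
      simp only [Rat.cast_one, one_mul]
      field_simp
      ring
  · refine finish G' a' (fun j c hjc => ⟨ha'sub j c hjc, fun hj0 => ?_, fun hjn => ?_⟩) (fun x _ => rfl)
    · by_cases hu0 : (u : ℕ) = 0
      · exact fun hc => hB ⟨hu0, j, hj0, by rw [hjc, hc]⟩
      · have : a (Fin.castSucc j) = some c := by
          rw [ha'j] at hjc
          rwa [Fin.succAbove_of_castSucc_lt u j
            (by rw [Fin.lt_def]; simp only [Fin.val_castSucc]; omega)] at hjc
        exact (ha _ c this).2.1 (by simpa using hj0)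
    · by_cases hul : u = Fin.last n
      · exact fun hc => hA ⟨hul, j, hjn, by rw [hjc, hc]⟩
      · have hun : (u : ℕ) < n := by
          have h1 := u.2
          have h2 : (u : ℕ) ≠ n := fun h => hul (Fin.ext h)
          omega
        have : a (Fin.succ j) = some c := by
          rw [ha'j] at hjc
          rwa [Fin.succAbove_of_le_castSucc u j
            (by rw [Fin.le_def]; simp only [Fin.val_castSucc]; omega)] at hjc
        exact (ha _ c this).2.2 (by simp only [Fin.val_succ]; omega)

end Unletter

end Summit.KontsevichZagierPeriods.ArrangementNormalForm.JanusBands
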